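/-
Copyright (c) 2026 the pub-hodgecm-mathlib formalisation cell (harness21).  Prover seat hodgecm-mathlib-LH4-p11 (g5), req620 Track A «(D-RAM) FOUR-FRAME» squad
(unit U2H_HSide, the (ρ2b′-X) road :418; bottom socket (A), recipe item 12 «the V-choice»).
-/
import Literature.NumberTheory.Automorphic.UnitaryThreeFourFrameDefs   -- ★ (valued-field letters)
import HarnessLib

/-!
# Crux `H413`, line LH4 «(D-RAM) FOUR-FRAME» — the (ρ2b′-X) road, bottom sockets: THE TUBE LETTERS OF A BLOCK ELEMENT CONGRUENT TO `1`

Cell `hodgecm-mathlib` (D-0151), FLOOR 0, crux item H413 = `stmt-HodgeConjecture-24833`; squad F0∕P3c∕LH4; bottom sockets (A)∕(B)∕(C): the bottom prover CHOOSES `V ∈ 𝓝 1`; by ★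
`exists_nhds_one_congrOne_endoEmbLocal` every `γ_H ∈ V` has `ι_v(γ_H)_w ≡ 1 (mod c)` ENTRYWISE.  This file turns that congruence into the tube letters the ★ organs want, by pure
valuation algebra on a `2 × 2` matrix `g` and a scalar `u` over a valued field: `|tr g − 2| ≤ |c|`, `|det g − 1| ≤ |c|`, `|tr² − 4det| ≤ |c|²`, `|u² − tr·u + det| ≤ |c|`; hence
`|tr g| = |2|` (GAP-lev's `htr`), ★ (C2)'s tube `|tr² − 4det| < |4|·|ϖ|²·|tr|²`, and a lower bound on the depth token `m` (the weld's `hmS`).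
THEOREMS ONLY (no `def`, no instance, no notation, no `sorry`, default heartbeats); lane `--supports stmt-HodgeConjecture-24833 --as helper` (count-neutral).
HONEST LABEL.  Count-neutral; nothing printed is asserted; (ρ2b′-X) stays OPEN; `HC_CM` is proved only modulo the 7 printed citations (2 remaining named inputs: hLiu418 =
`stmt-HodgeConjecture-24832`, h413 = `stmt-HodgeConjecture-24833`) until rung 0 closes.

## References
* [Rogawski1990] J. D. Rogawski, *Automorphic Representations of Unitary Groups in Three Variables*, Ann. of Math. Stud. 123 (1990), §4.9 p. 54 (elements near `1`), p. 55.
* [BernsteinZelevinsky1976] I. N. Bernstein, A. V. Zelevinsky, *Representations of GL(n, F)*, Russian Math. Surveys 31 (1976), §1.1 (congruence neighbourhoods).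
-/

set_option autoImplicit false

noncomputable section

open scoped Valued WithZero Matrix
open WithZero

namespace Summit.HodgeConjecture.HodgeConjecture.Cruxes.H413.F0P3cDyRamTypeTwoTubeLetters

variable {K : Type*} [Field K] [Valued K ℤᵐ⁰]

/-- Entries of a matrix congruent to `1` are integral (`|c| ≤ 1`). [cite: BernsteinZelevinsky1976, §1.1] -/
theorem v_apply_le_one_of_congr {g : Matrix (Fin 2) (Fin 2) K} {c : K} (hc1 : Valued.v c ≤ 1)
    (hg : ∀ i j, Valued.v (g i j - (1 : Matrix (Fin 2) (Fin 2) K) i j) ≤ Valued.v c) (i j : Fin 2) : Valued.v (g i j) ≤ 1 := by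
  have h := hg i j
  have h1 : Valued.v ((1 : Matrix (Fin 2) (Fin 2) K) i j) ≤ 1 := by
    rw [Matrix.one_apply]; split_ifs <;> simp
  calc Valued.v (g i j) = Valued.v ((g i j - (1 : Matrix (Fin 2) (Fin 2) K) i j) + (1 : Matrix (Fin 2) (Fin 2) K) i j) := by rw [sub_add_cancel]
    _ ≤ max (Valued.v (g i j - (1 : Matrix (Fin 2) (Fin 2) K) i j)) (Valued.v ((1 : Matrix (Fin 2) (Fin 2) K) i j)) := Valuation.map_add _ _ _
    _ ≤ 1 := max_le (h.trans hc1) h1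

/-- **`|tr g − 2| ≤ |c|`** for `g ≡ 1 (mod c)` entrywise. [cite: Rogawski1990, §4.9 p. 54] -/
theorem v_trace_sub_two_le {g : Matrix (Fin 2) (Fin 2) K} {c : K}
    (hg : ∀ i j, Valued.v (g i j - (1 : Matrix (Fin 2) (Fin 2) K) i j) ≤ Valued.v c) : Valued.v (g.trace - 2) ≤ Valued.v c := by
  have h0 := hg 0 0
  have h1 := hg 1 1
  simp only [Matrix.one_apply_eq] at h0 h1
  rw [Matrix.trace_fin_two, show g 0 0 + g 1 1 - 2 = (g 0 0 - 1) + (g 1 1 - 1) by ring]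
  exact (Valuation.map_add _ _ _).trans (max_le h0 h1)

/-- **`|det g − 1| ≤ |c|`** for `g ≡ 1 (mod c)` entrywise (`|c| ≤ 1`). [cite: Rogawski1990, §4.9 p. 54] -/
theorem v_det_sub_one_le {g : Matrix (Fin 2) (Fin 2) K} {c : K} (hc1 : Valued.v c ≤ 1)
    (hg : ∀ i j, Valued.v (g i j - (1 : Matrix (Fin 2) (Fin 2) K) i j) ≤ Valued.v c) : Valued.v (g.det - 1) ≤ Valued.v c := by
  have h00 := hg 0 0
  have h11 := hg 1 1
  have h01 := hg 0 1
  have h10 := hg 1 0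
  simp only [Matrix.one_apply_eq, Matrix.one_apply_ne (show (0 : Fin 2) ≠ 1 by decide), Matrix.one_apply_ne (show (1 : Fin 2) ≠ 0 by decide), sub_zero] at h00 h11 h01 h10
  have hg11 : Valued.v (g 1 1) ≤ 1 := v_apply_le_one_of_congr hc1 hg 1 1
  rw [Matrix.det_fin_two, show g 0 0 * g 1 1 - g 0 1 * g 1 0 - 1 = (g 0 0 - 1) * g 1 1 + (g 1 1 - 1) + -(g 0 1 * g 1 0) by ring]
  refine (Valuation.map_add _ _ _).trans (max_le ((Valuation.map_add _ _ _).trans (max_le ?_ h11)) ?_)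
  · rw [map_mul]; exact (mul_le_mul' h00 hg11).trans_eq (mul_one _)
  · rw [Valuation.map_neg, map_mul]
    exact (mul_le_mul' h01 (h10.trans hc1)).trans_eq (mul_one _)

/-- **`|tr² − 4det| ≤ |c|²`** for `g ≡ 1 (mod c)` entrywise: `tr² − 4det = (g₀₀ − g₁₁)² + 4g₀₁g₁₀`. [cite: Rogawski1990, §4.9 p. 55] -/
theorem v_disc_le_sq {g : Matrix (Fin 2) (Fin 2) K} {c : K}
    (hg : ∀ i j, Valued.v (g i j - (1 : Matrix (Fin 2) (Fin 2) K) i j) ≤ Valued.v c) : Valued.v (g.trace ^ 2 - 4 * g.det) ≤ Valued.v c ^ 2 := by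
  have h00 := hg 0 0
  have h11 := hg 1 1
  have h01 := hg 0 1
  have h10 := hg 1 0
  simp only [Matrix.one_apply_eq, Matrix.one_apply_ne (show (0 : Fin 2) ≠ 1 by decide), Matrix.one_apply_ne (show (1 : Fin 2) ≠ 0 by decide), sub_zero] at h00 h11 h01 h10
  have hdiff : Valued.v (g 0 0 - g 1 1) ≤ Valued.v c := by
    rw [show g 0 0 - g 1 1 = (g 0 0 - 1) + -(g 1 1 - 1) by ring]
    exact (Valuation.map_add _ _ _).trans (max_le h00 (by rw [Valuation.map_neg]; exact h11))
  have h2 : Valued.v (2 : K) ≤ 1 := by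
    have h := Valuation.map_add Valued.v (1 : K) 1
    rw [map_one, max_self, one_add_one_eq_two] at h
    exact h
  have h4 : Valued.v (4 : K) ≤ 1 := by
    rw [show (4 : K) = 2 * 2 by norm_num, map_mul]; exact mul_le_one' h2 h2
  rw [Matrix.trace_fin_two, Matrix.det_fin_two,
    show (g 0 0 + g 1 1) ^ 2 - 4 * (g 0 0 * g 1 1 - g 0 1 * g 1 0) = (g 0 0 - g 1 1) ^ 2 + 4 * (g 0 1 * g 1 0) by ring]
  refine (Valuation.map_add _ _ _).trans (max_le ?_ ?_)
  · rw [map_pow]; exact pow_le_pow_left' hdiff 2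
  · rw [map_mul, map_mul, sq]
    exact (mul_le_mul' h4 (mul_le_mul' h01 h10)).trans_eq (one_mul _)

/-- **`|u² − tr·u + det| ≤ |c|`** (the value `χ_g(u)`) for `g ≡ 1`, `u ≡ 1 (mod c)`, `|c| ≤ 1`: `χ_g(u) = (u−1)² − (tr−2)·u + (det−1)`. [cite: Rogawski1990, §4.9 p. 55] -/
theorem v_quadratic_le {g : Matrix (Fin 2) (Fin 2) K} {u c : K} (hc1 : Valued.v c ≤ 1)
    (hg : ∀ i j, Valued.v (g i j - (1 : Matrix (Fin 2) (Fin 2) K) i j) ≤ Valued.v c) (hu : Valued.v (u - 1) ≤ Valued.v c) :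
    Valued.v (u ^ 2 - g.trace * u + g.det) ≤ Valued.v c := by
  have htr := v_trace_sub_two_le hg
  have hdet := v_det_sub_one_le hc1 hg
  have hu1 : Valued.v u ≤ 1 := by
    calc Valued.v u = Valued.v ((u - 1) + 1) := by rw [sub_add_cancel]
      _ ≤ max (Valued.v (u - 1)) (Valued.v (1 : K)) := Valuation.map_add _ _ _
      _ ≤ 1 := max_le (hu.trans hc1) (by rw [map_one])
  rw [show u ^ 2 - g.trace * u + g.det = (u - 1) * (u - 1) + -((g.trace - 2) * u) + (g.det - 1) by ring]
  refine (Valuation.map_add _ _ _).trans (max_le ((Valuation.map_add _ _ _).trans (max_le ?_ ?_)) hdet)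
  · rw [map_mul]; exact (mul_le_mul' hu (hu.trans hc1)).trans_eq (mul_one _)
  · rw [Valuation.map_neg, map_mul]; exact (mul_le_mul' htr hu1).trans_eq (mul_one _)

/-- **`|tr g| = |2|`** once `|c| < |2|` (GAP-lev's `htr`). [cite: Rogawski1990, §4.9 p. 54] -/
theorem v_trace_eq_v_two {g : Matrix (Fin 2) (Fin 2) K} {c : K} (hc2 : Valued.v c < Valued.v (2 : K))
    (hg : ∀ i j, Valued.v (g i j - (1 : Matrix (Fin 2) (Fin 2) K) i j) ≤ Valued.v c) : Valued.v g.trace = Valued.v (2 : K) := by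
  have h := (v_trace_sub_two_le hg).trans_lt hc2
  have := Valuation.map_add_eq_of_lt_left Valued.v h
  rwa [add_sub_cancel] at this

/-- **★ (C2)'s TUBE `|tr² − 4det| < |4|·|ϖ|²·|tr|²`** once `|c|² < |4|·|ϖ|²·|2|²` and `|c| < |2|`. [cite: Rogawski1990, §4.9 p. 55] -/
theorem v_disc_lt_tube {g : Matrix (Fin 2) (Fin 2) K} {c ϖ : K} (hc2 : Valued.v c < Valued.v (2 : K))
    (hcϖ : Valued.v c ^ 2 < Valued.v (4 : K) * Valued.v ϖ ^ 2 * Valued.v (2 : K) ^ 2)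
    (hg : ∀ i j, Valued.v (g i j - (1 : Matrix (Fin 2) (Fin 2) K) i j) ≤ Valued.v c) :
    Valued.v (g.trace ^ 2 - 4 * g.det) < Valued.v (4 : K) * Valued.v ϖ ^ 2 * Valued.v g.trace ^ 2 := by
  rw [v_trace_eq_v_two hc2 hg]
  exact (v_disc_le_sq hg).trans_lt hcϖ

/-- **THE DEPTH TOKEN IS LARGE IN THE TUBE**: if `|u² − tr·u + det| = exp(−2m)` (the `m`-token read at `w`) and `|c| ≤ exp(−k)`, then `k ≤ 2m` (so `S − 1 ≤ m` once `k ≥ 2S`).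
[cite: Rogawski1990, §4.9 p. 55] -/
theorem le_two_mul_depth_of_congr {g : Matrix (Fin 2) (Fin 2) K} {u c : K} (hc1 : Valued.v c ≤ 1)
    (hg : ∀ i j, Valued.v (g i j - (1 : Matrix (Fin 2) (Fin 2) K) i j) ≤ Valued.v c) (hu : Valued.v (u - 1) ≤ Valued.v c)
    {m : ℕ} (htok : Valued.v (u ^ 2 - g.trace * u + g.det) = exp (-(2 * (m : ℤ)))) {k : ℕ} (hck : Valued.v c ≤ exp (-(k : ℤ))) :
    k ≤ 2 * m := by
  have h := ((v_quadratic_le hc1 hg hu).trans hck)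
  rw [htok, exp_le_exp] at h
  omega

end Summit.HodgeConjecture.HodgeConjecture.Cruxes.H413.F0P3cDyRamTypeTwoTubeLetters

end
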